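import Summits.NavierStokesRegularity.NavierStokesRegularity.Theses.AxisymmetricExtremality
import Summits.NavierStokesRegularity.NavierStokesRegularity.Theorems.AxisymmetricExtremalityAxisymmetricKatoGlobalStubSereginLogSwirlOriginStep3LocalClass
import Summits.NavierStokesRegularity.NavierStokesRegularity.Theorems.AxisymmetricExtremalityAxisymmetricKatoGlobalStubSeregin2020TypeIINoSwirlCoreCutoff
import Summits.NavierStokesRegularity.NavierStokesRegularity.Theorems.AxisymmetricExtremalityAxisymmetricKatoGlobalStubSereginLogSwirlOriginLerayLogHardy
import Mathlib.Analysis.SpecialFunctions.SmoothTransition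
import HarnessLib

/-!
# Seregin 2022, §2 Step 3 for the LOCAL smooth class (X): the cut-off globalisation `χV` of the
# Seregin–Zajaczkowski representative — smooth axisymmetric slices, uniform-in-`x` time moduli,
# and the vorticity equation near the cut-off — crux stmt-NavierStokesRegularity-15453
# (`AxisymmetricExtremality.AxisymmetricKatoGlobal`), line registered, support for stub `stub_sereginLogSwirlOrigin`

Support file (`--supports stmt-NavierStokesRegularity-15453`; theorems only, everything proved)
toward the registered stub `stub_sereginLogSwirlOrigin` = the named fact
`Literature.Analysis.FluidPDE.seregin2022_logSwirl_regularAtOrigin` (G. Seregin, J. Math. Fluid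
Mech. 24 (2022), Paper 27 = arXiv:2201.00153, §2). The final reduction of the fact leaves a core
about a representative `V` in the Seregin–Zajaczkowski class `IsSmoothAxisymmetricSolutionOn S V q`
on an open cylinder `S ⊇ I × 𝒞` (suitable weak solution, `C^∞` slices, jointly continuous
spatial derivatives; no `∂ₜV`), while the Step-3 energy scheme for the local class
(`cutoff_energy_keyEstimate_local_unconditional` and its moduli form, sibling
`…Step3LocalKeyEstimate`) is run for a family of GLOBALLY smooth axisymmetric fields. This file
builds that family as `v t = χ • V t` for a smooth axisymmetric cut-off `χ` equal to `1` on the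
small cylinder `𝒞(r₀)` carrying the Step-1 cut-off `η` and supported in `𝒞(r₁)`, `r₁ < 1`
(`v = V` near `supp η`, so all quantities of Step 3 are those of the solution there):

* `exists_cylCutoff` — a smooth axisymmetric `χ : ℝ³ → [0, 1]`, `χ = 1` on `𝒞(r₀)`,
  `tsupport χ ⊆ 𝒞(r₁)` (product of `Real.smoothTransition` profiles in `x₀² + x₁²` and `±x₂`);
* `cutoffField_contDiff_of_tsupport_subset`, `cutoffField_isAxisymmetric_of_tsupport_subset` —
  `χ • V t` is globally `C^∞` and axisymmetric;
* `unifTime_cutoffField_of_tsupport_subset` — its `x`-derivatives of every order are continuous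
  in `t` uniformly in `x` (Leibniz on `tsupport χ`, uniform continuity of the `D_xʲV` on
  `[t − δ₀, t + δ₀] × tsupport χ`, `exists_forall_norm_iteratedFDeriv_sub_le`; the generic-cut-off
  form of `unifTime_radialCutoffField`);
* `cutoffFamily_package` (registered sub-goal) — **for the Seregin–Zajaczkowski class on
  `S ⊇ I × 𝒞(0, 1)`, `I` open, and `v t = χ • V t`: smooth axisymmetric slices vanishing off
  `B̄(0, 2)`, uniform-in-`x` time moduli of all `D_xᵏv` on `I`, `v t = V t` near every point of
  `𝒞(r₀)`, `div v = 0` and the pointwise vorticity equation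
  `d/ds curl (v s) x = Δω − Dω[v] + Dv[ω]` on `I × 𝒞(r₀)`** — exactly the structural hypotheses
  of the local key estimate (`hasDerivAt_curl_of_isSmoothAxisymmetricSolutionOn`,
  `vorticity_classical_of_isDistributionalNSSolutionOn`).

## Mathlib / tree search

Tree: `unifTime_radialCutoffField`, `radialCutoffField_contDiff / _isAxisymmetric / _local`
(`…Seregin2020TypeIINoSwirlCoreCutoffRadii`, ball cut-offs), `exists_forall_norm_iteratedFDeriv_sub_le`
(`…Seregin2020TypeIINoSwirlCoreCutoff`), `hasDerivAt_curl_of_isSmoothAxisymmetricSolutionOn`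
(`…Step3LocalClass`), `vorticity_classical_of_isDistributionalNSSolutionOn`,
`IsSmoothAxisymmetricSolutionOn.continuousOn_iteratedFDeriv / .contDiffAt / .axisymmetric`,
`SereginSverak2009.isOpen_spaceCyl`, `mem_spaceCyl`, `spaceCyl_subset_closedBall` (`…LerayLogHardy`),
`cylRadius_rotZ`, `rotZ_apply_two`. Mathlib: `Real.smoothTransition` (`one_of_one_le`,
`zero_of_nonpos`, `nonneg`, `le_one`, `contDiff`), `norm_iteratedFDerivWithin_smul_le`,
`iteratedFDerivWithin_of_isOpen`, `Filter.EventuallyEq.iteratedFDeriv`.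
`lean search 'cylCutoff|cutoffFamily_package' --decl`: no matches (2026-08-17).

## References

* G. Seregin, J. Math. Fluid Mech. 24 (2022), Paper No. 27 = arXiv:2201.00153, §2 Steps 1, 3
  (arXiv pp. 5–7). [`Seregin2022LocalAxisym`]
* G. Seregin, W. Zajaczkowski, SIAM J. Math. Anal. 39 (2007) 669–685, Prop. 4.1 (the class).
  [`SereginZajaczkowski2007`]
-/

noncomputable section

open MeasureTheory Set Filter Topology Function Metric TopologicalSpace
open scoped ContDiff Laplacian
open Literature.Analysis.FluidPDE Literature.Analysis.FluidPDE.SereginZajaczkowski2007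

-- `<Problem> = <Summit>` duplicates a namespace component by design (lakefile sets the same option).
set_option linter.dupNamespace false

namespace Summit.NavierStokesRegularity.NavierStokesRegularity.Theorems.AxisymmetricKatoGlobal.EulerScaling

/-! ### A smooth axisymmetric cylindrical cut-off -/

section CylCutoff

/-- **A smooth axisymmetric cut-off adapted to two coaxial cylinders**: for `0 < r₀ < r₁` there is
`χ ∈ C^∞(ℝ³; [0, 1])`, invariant under rotations about the axis, with `χ = 1` on
`𝒞(r₀) = {|x'| < r₀, |x₃| < r₀}` and `tsupport χ ⊆ 𝒞(r₁)` (product of smooth transition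
profiles in `x₀² + x₁²`, `x₂`, `−x₂` between the levels `a = (2r₀ + r₁)/3`, `b = (r₀ + 2r₁)/3`).
[folklore] -/
theorem exists_cylCutoff {r₀ r₁ : ℝ} (h₀ : 0 < r₀) (h₀₁ : r₀ < r₁) :
    ∃ χ : EuclideanSpace ℝ (Fin 3) → ℝ, ContDiff ℝ ∞ χ ∧ IsAxisymmetricScalar χ ∧
      (∀ y, 0 ≤ χ y ∧ χ y ≤ 1) ∧ (∀ y ∈ SereginSverak2009.spaceCyl 0 r₀, χ y = 1) ∧
      tsupport χ ⊆ SereginSverak2009.spaceCyl 0 r₁ := by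
  set a : ℝ := (2 * r₀ + r₁) / 3 with ha
  set b : ℝ := (r₀ + 2 * r₁) / 3 with hb
  have hab : a < b := by rw [ha, hb]; linarith
  have h0a : r₀ < a := by rw [ha]; linarith
  have hb1 : b < r₁ := by rw [hb]; linarith
  have hapos : 0 < a := h₀.trans h0a
  -- the 1D profiles `g c d s = smoothTransition ((d - s)/(d - c))`: `= 1` for `s ≤ c`, `= 0` for `s ≥ d`
  set g : ℝ → ℝ → ℝ → ℝ := fun c d s => Real.smoothTransition ((d - s) / (d - c)) with hg
  have hg1 : ∀ {c d s : ℝ}, c < d → s ≤ c → g c d s = 1 := fun {c d s} hcd hs =>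
    Real.smoothTransition.one_of_one_le (by rw [le_div_iff₀ (by linarith)]; linarith)
  have hg0 : ∀ {c d s : ℝ}, c < d → d ≤ s → g c d s = 0 := fun {c d s} hcd hs =>
    Real.smoothTransition.zero_of_nonpos (div_nonpos_of_nonpos_of_nonneg (by linarith) (by linarith))
  have hgs : ∀ c d : ℝ, ContDiff ℝ ∞ (g c d) := fun c d =>
    Real.smoothTransition.contDiff.comp ((contDiff_const.sub contDiff_id).div_const _)
  set χ : EuclideanSpace ℝ (Fin 3) → ℝ := fun y =>
    g (a ^ 2) (b ^ 2) (y 0 ^ 2 + y 1 ^ 2) * (g a b (y 2) * g a b (-(y 2))) with hχ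
  have hab2 : a ^ 2 < b ^ 2 := by nlinarith
  refine ⟨χ, ?_, ?_, ?_, ?_, ?_⟩
  · have h2 : ContDiff ℝ ∞ fun y : EuclideanSpace ℝ (Fin 3) => y 2 :=
      contDiff_piLp_apply (𝕜 := ℝ) (p := 2) (i := (2 : Fin 3))
    exact ((hgs _ _).comp contDiff_horizSq).mul (((hgs a b).comp h2).mul ((hgs a b).comp h2.neg))
  · intro θ y
    simp only [hχ, rotZ_apply_two, ← cylRadius_sq, cylRadius_rotZ]
  · intro y
    exact ⟨mul_nonneg (Real.smoothTransition.nonneg _) (mul_nonneg (Real.smoothTransition.nonneg _)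
      (Real.smoothTransition.nonneg _)), mul_le_one₀ (Real.smoothTransition.le_one _)
        (mul_nonneg (Real.smoothTransition.nonneg _) (Real.smoothTransition.nonneg _))
        (mul_le_one₀ (Real.smoothTransition.le_one _) (Real.smoothTransition.nonneg _)
          (Real.smoothTransition.le_one _))⟩
  · intro y hy
    have hy' : cylRadius y < r₀ ∧ |y 2| < r₀ := by
      simpa [SereginSverak2009.mem_spaceCyl] using hy
    have hr : y 0 ^ 2 + y 1 ^ 2 ≤ a ^ 2 := by
      rw [← cylRadius_sq]; nlinarith [cylRadius_nonneg y, hy'.1]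
    have h2 : |y 2| ≤ a := by linarith [hy'.2]
    simp only [hχ]
    rw [hg1 hab2 hr, hg1 hab (abs_le.1 h2).2, hg1 hab (by linarith [(abs_le.1 h2).1]), mul_one, mul_one]
  · -- `{χ ≠ 0} ⊆ {ρ ≤ b², |y₂| ≤ b}`, a closed subset of `𝒞(r₁)`
    have hsupp : support χ ⊆ {y : EuclideanSpace ℝ (Fin 3) | y 0 ^ 2 + y 1 ^ 2 ≤ b ^ 2 ∧ |y 2| ≤ b} := by
      intro y hy
      rw [mem_support] at hy
      by_contra hc
      simp only [mem_setOf_eq, not_and_or, not_le] at hc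
      apply hy
      simp only [hχ]
      rcases hc with hc | hc
      · rw [hg0 hab2 hc.le, zero_mul]
      · rcases lt_abs.1 hc with hc' | hc'
        · rw [hg0 hab hc'.le]; ring
        · rw [hg0 hab (s := -(y 2)) hc'.le]; ring
    have hcl : IsClosed {y : EuclideanSpace ℝ (Fin 3) | y 0 ^ 2 + y 1 ^ 2 ≤ b ^ 2 ∧ |y 2| ≤ b} := by
      have hc1 : Continuous fun y : EuclideanSpace ℝ (Fin 3) => y 0 ^ 2 + y 1 ^ 2 := (contDiff_horizSq (n := 0)).continuous
      have hc2 : Continuous fun y : EuclideanSpace ℝ (Fin 3) => |y 2| :=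
        (contDiff_piLp_apply (𝕜 := ℝ) (p := 2) (n := 0) (i := (2 : Fin 3))).continuous.abs
      exact (isClosed_le hc1 continuous_const).inter (isClosed_le hc2 continuous_const)
    refine (closure_minimal hsupp hcl).trans fun y hy => ?_
    have hr : cylRadius y ≤ b := by
      have h1 : cylRadius y ^ 2 ≤ b ^ 2 := by rw [cylRadius_sq]; exact hy.1
      by_contra hlt
      have hlt' : b < cylRadius y := not_le.1 hlt
      nlinarith [cylRadius_nonneg y, hapos.trans hab]
    have hm : cylRadius y < r₁ ∧ |y 2| < r₁ := ⟨hr.trans_lt hb1, hy.2.trans_lt hb1⟩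
    simpa [SereginSverak2009.mem_spaceCyl] using hm

end CylCutoff

/-! ### The cut-off field `χ • V`: smoothness, axisymmetry, uniform-in-`x` time moduli -/

section CutoffField

variable {V : ℝ → EuclideanSpace ℝ (Fin 3) → EuclideanSpace ℝ (Fin 3)} {χ : EuclideanSpace ℝ (Fin 3) → ℝ}
  {U : Set (EuclideanSpace ℝ (Fin 3))} {I : Set ℝ}

/-- Off `tsupport χ` the cut-off field vanishes near the point. [folklore] -/
theorem cutoffField_eventuallyEq_zero' (W : EuclideanSpace ℝ (Fin 3) → EuclideanSpace ℝ (Fin 3))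
    {y : EuclideanSpace ℝ (Fin 3)} (hy : y ∉ tsupport χ) :
    (fun y => χ y • W y) =ᶠ[𝓝 y] fun _ => 0 := by
  filter_upwards [notMem_tsupport_iff_eventuallyEq.1 hy] with z hz
  rw [hz, Pi.zero_apply, zero_smul]

/-- Where `χ = 1` (on an open set) the cut-off field is the field near the point. [folklore] -/
theorem cutoffField_eventuallyEq' (W : EuclideanSpace ℝ (Fin 3) → EuclideanSpace ℝ (Fin 3))
    {O : Set (EuclideanSpace ℝ (Fin 3))} (hO : IsOpen O) (h1 : ∀ y ∈ O, χ y = 1)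
    {x : EuclideanSpace ℝ (Fin 3)} (hx : x ∈ O) : (fun y => χ y • W y) =ᶠ[𝓝 x] W := by
  filter_upwards [hO.mem_nhds hx] with z hz
  rw [h1 z hz, one_smul]

/-- **The cut-off field is globally smooth** when `tsupport χ ⊆ U`, `U` open, and the field is
smooth at the points of `U`. [folklore] -/
theorem cutoffField_contDiff_of_tsupport_subset (hχ : ContDiff ℝ ∞ χ)
    (hχU : tsupport χ ⊆ U) {W : EuclideanSpace ℝ (Fin 3) → EuclideanSpace ℝ (Fin 3)}
    (hW : ∀ y ∈ U, ContDiffAt ℝ ∞ W y) : ContDiff ℝ ∞ fun y => χ y • W y := by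
  refine contDiff_iff_contDiffAt.2 fun y => ?_
  by_cases hy : y ∈ tsupport χ
  · exact hχ.contDiffAt.smul (hW y (hχU hy))
  · exact (contDiffAt_const (c := (0 : EuclideanSpace ℝ (Fin 3)))).congr_of_eventuallyEq
      (cutoffField_eventuallyEq_zero' W hy)

/-- **The cut-off field is axisymmetric** when `χ` is an axisymmetric scalar and the field is
axisymmetric at the points of `U ⊇ tsupport χ`. [folklore] -/
theorem cutoffField_isAxisymmetric_of_tsupport_subset (hχax : IsAxisymmetricScalar χ)
    (hχU : tsupport χ ⊆ U) {W : EuclideanSpace ℝ (Fin 3) → EuclideanSpace ℝ (Fin 3)}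
    (hW : ∀ θ : ℝ, ∀ y ∈ U, W (rotZ θ y) = rotZ θ (W y)) : IsAxisymmetric fun y => χ y • W y := by
  intro θ y
  show χ (rotZ θ y) • W (rotZ θ y) = rotZ θ (χ y • W y)
  rw [hχax θ y]
  by_cases hy : χ y = 0
  · rw [hy, zero_smul, zero_smul]
    ext i
    fin_cases i <;> simp [rotZ]
  · rw [hW θ y (hχU (subset_tsupport _ (mem_support.2 hy))), ← rotZL_apply, ← rotZL_apply, map_smul]

/-- A uniform bound for the derivatives of order `≤ k` of a smooth compactly supported function.
[folklore] -/
theorem exists_forall_norm_iteratedFDeriv_le_of_hasCompactSupport (hχ : ContDiff ℝ ∞ χ)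
    (hχc : HasCompactSupport χ) (k : ℕ) :
    ∃ C : ℝ, 0 ≤ C ∧ ∀ i ≤ k, ∀ y, ‖iteratedFDeriv ℝ i χ y‖ ≤ C := by
  have hone : ∀ i : ℕ, ∃ C : ℝ, ∀ y, ‖iteratedFDeriv ℝ i χ y‖ ≤ C := fun i =>
    (hχ.continuous_iteratedFDeriv (by exact_mod_cast le_top)).bounded_above_of_compact_support
      (hχc.iteratedFDeriv i)
  induction k with
  | zero =>
    obtain ⟨C, hC⟩ := hone 0
    exact ⟨max C 0, le_max_right _ _, fun i hi y => by
      obtain rfl : i = 0 := Nat.le_zero.1 hi; exact (hC y).trans (le_max_left _ _)⟩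
  | succ k ih =>
    obtain ⟨C₁, hC₁0, hC₁⟩ := ih
    obtain ⟨C₂, hC₂⟩ := hone (k + 1)
    refine ⟨max C₁ C₂, le_max_of_le_left hC₁0, fun i hi y => ?_⟩
    rcases Nat.of_le_succ hi with hi' | rfl
    · exact (hC₁ i hi' y).trans (le_max_left _ _)
    · exact (hC₂ y).trans (le_max_right _ _)

/-- **Uniform-in-`x` time moduli of all `x`-derivatives of the cut-off field** (the hypothesis of
`continuousOn_radQuot_family` / `unifTime_vorticityRHS`): on an open time set `I`, if the slices
`V τ`, `τ ∈ I`, are smooth at the points of an open `U ⊇ tsupport χ` (`χ` smooth, compactly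
supported) and all `D_xⁿ V` are jointly continuous on `I × U`, then for every `k`, `τ ∈ I`,
`ε > 0` there is `δ > 0` with `‖D_xᵏ(χV)(τ', y) − D_xᵏ(χV)(τ, y)‖ ≤ ε` for `τ' ∈ I`,
`|τ' − τ| < δ` and ALL `y`: off `tsupport χ` both terms vanish; on it, the Leibniz bound and
the uniform continuity of `D_xʲV`, `j ≤ k`, on `[τ − δ₀, τ + δ₀] × tsupport χ`. The generic
cut-off form of `unifTime_radialCutoffField`. [folklore] -/
theorem unifTime_cutoffField_of_tsupport_subset (hI : IsOpen I) (hU : IsOpen U) (hχ : ContDiff ℝ ∞ χ)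
    (hχc : HasCompactSupport χ) (hχU : tsupport χ ⊆ U)
    (hVs : ∀ τ ∈ I, ∀ y ∈ U, ContDiffAt ℝ ∞ (V τ) y)
    (hVc : ∀ n : ℕ, ContinuousOn
      (fun w : ℝ × EuclideanSpace ℝ (Fin 3) => iteratedFDeriv ℝ n (V w.1) w.2) (I ×ˢ U)) :
    ∀ k : ℕ, ∀ τ ∈ I, ∀ ε > 0, ∃ δ > 0, ∀ τ' ∈ I, |τ' - τ| < δ → ∀ y,
      ‖iteratedFDeriv ℝ k (fun y => χ y • V τ' y) y - iteratedFDeriv ℝ k (fun y => χ y • V τ y) y‖ ≤ ε := by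
  intro k τ hτ ε hε
  have hcast : ∀ m : ℕ, ((m : ℕ∞) : WithTop ℕ∞) ≤ ((⊤ : ℕ∞) : WithTop ℕ∞) := fun m => by
    exact_mod_cast le_top
  obtain ⟨Cχ, hCχ0, hCχ⟩ := exists_forall_norm_iteratedFDeriv_le_of_hasCompactSupport hχ hχc k
  -- a compact time window inside `I`
  obtain ⟨δ₀, hδ₀, hwin⟩ : ∃ δ₀ > 0, Icc (τ - δ₀) (τ + δ₀) ⊆ I := by
    obtain ⟨r, hr, hrI⟩ := Metric.isOpen_iff.1 hI τ hτ
    refine ⟨r / 2, half_pos hr, fun s hs => hrI ?_⟩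
    rw [mem_ball, Real.dist_eq, abs_lt]
    constructor <;> linarith [hs.1, hs.2]
  set K : Set (ℝ × EuclideanSpace ℝ (Fin 3)) := Icc (τ - δ₀) (τ + δ₀) ×ˢ tsupport χ with hK
  have hKc : IsCompact K := isCompact_Icc.prod hχc
  have hKsub : K ⊆ I ×ˢ U := prod_mono hwin hχU
  have hη : 0 < ε / (2 ^ k * Cχ + 1) := by positivity
  obtain ⟨δ₁, hδ₁, hmod⟩ := exists_forall_norm_iteratedFDeriv_sub_le hKc hKsub hVc k hη
  refine ⟨min δ₀ δ₁, lt_min hδ₀ hδ₁, fun τ' hτ' hlt y => ?_⟩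
  have hlt₀ : |τ' - τ| < δ₀ := hlt.trans_le (min_le_left _ _)
  have hlt₁ : |τ' - τ| < δ₁ := hlt.trans_le (min_le_right _ _)
  by_cases hy : y ∈ tsupport χ
  · -- ## on `tsupport χ`: Leibniz
    have hyU : y ∈ U := hχU hy
    have hτ'w : τ' ∈ Icc (τ - δ₀) (τ + δ₀) := by
      rw [abs_lt] at hlt₀; exact ⟨by linarith, by linarith⟩
    have hτw : τ ∈ Icc (τ - δ₀) (τ + δ₀) := ⟨by linarith, by linarith⟩
    have ha : ((τ', y) : ℝ × EuclideanSpace ℝ (Fin 3)) ∈ K := ⟨hτ'w, hy⟩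
    have hb : ((τ, y) : ℝ × EuclideanSpace ℝ (Fin 3)) ∈ K := ⟨hτw, hy⟩
    have hab : dist ((τ', y) : ℝ × EuclideanSpace ℝ (Fin 3)) (τ, y) < δ₁ := by
      rw [Prod.dist_eq, dist_self, Real.dist_eq]
      exact max_lt hlt₁ (by simpa using hδ₁)
    set D : EuclideanSpace ℝ (Fin 3) → EuclideanSpace ℝ (Fin 3) := V τ' - V τ with hD
    have hDs : ContDiffOn ℝ k D U := fun z hz =>
      (((hVs τ' hτ' z hz).sub (hVs τ hτ z hz)).of_le (hcast k)).contDiffWithinAt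
    have hχs : ContDiffOn ℝ k χ U := (hχ.of_le (hcast k)).contDiffOn
    have hdiff : (fun y => χ y • V τ' y) - (fun y => χ y • V τ y) = fun y => χ y • D y := by
      funext z
      simp only [Pi.sub_apply, hD, smul_sub]
    have hWτ' : ContDiff ℝ ∞ fun y => χ y • V τ' y :=
      cutoffField_contDiff_of_tsupport_subset hχ hχU (hVs τ' hτ')
    have hWτ : ContDiff ℝ ∞ fun y => χ y • V τ y :=
      cutoffField_contDiff_of_tsupport_subset hχ hχU (hVs τ hτ)
    rw [← iteratedFDeriv_sub_apply (hWτ'.of_le (hcast k)).contDiffAt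
      (hWτ.of_le (hcast k)).contDiffAt, hdiff, ← iteratedFDerivWithin_of_isOpen k hU hyU]
    have hleib := norm_iteratedFDerivWithin_smul_le (𝕜 := ℝ) hχs hDs hU.uniqueDiffOn hyU
      (n := k) le_rfl
    refine hleib.trans ?_
    have hterm : ∀ i ∈ Finset.range (k + 1),
        (k.choose i : ℝ) * ‖iteratedFDerivWithin ℝ i χ U y‖ * ‖iteratedFDerivWithin ℝ (k - i) D U y‖ ≤
        (k.choose i : ℝ) * Cχ * (ε / (2 ^ k * Cχ + 1)) := by
      intro i hi
      have hik : i ≤ k := Nat.lt_succ_iff.1 (Finset.mem_range.1 hi)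
      rw [iteratedFDerivWithin_of_isOpen i hU hyU, iteratedFDerivWithin_of_isOpen (k - i) hU hyU]
      have h1 : ‖iteratedFDeriv ℝ (k - i) D y‖ ≤ ε / (2 ^ k * Cχ + 1) := by
        rw [hD, iteratedFDeriv_sub_apply ((hVs τ' hτ' y hyU).of_le (hcast (k - i)))
          ((hVs τ hτ y hyU).of_le (hcast (k - i)))]
        exact hmod (k - i) (Nat.sub_le k i) (τ', y) ha (τ, y) hb hab
      have h2 := hCχ i hik y
      have h3 : (0 : ℝ) ≤ k.choose i := Nat.cast_nonneg _
      exact mul_le_mul (mul_le_mul_of_nonneg_left h2 h3) h1 (norm_nonneg _) (by positivity)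
    refine (Finset.sum_le_sum hterm).trans ?_
    rw [← Finset.sum_mul, ← Finset.sum_mul]
    have hsum : ∑ i ∈ Finset.range (k + 1), (k.choose i : ℝ) = 2 ^ k := by
      rw [← Nat.cast_sum, Nat.sum_range_choose]; norm_num
    rw [hsum]
    have hA : 0 ≤ (2 : ℝ) ^ k * Cχ := mul_nonneg (pow_nonneg zero_le_two k) hCχ0
    calc (2 : ℝ) ^ k * Cχ * (ε / (2 ^ k * Cχ + 1)) = ε * (2 ^ k * Cχ / (2 ^ k * Cχ + 1)) := by ring
      _ ≤ ε * 1 := by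
          refine mul_le_mul_of_nonneg_left ?_ hε.le
          rw [div_le_one (by positivity)]
          linarith
      _ = ε := mul_one ε
  · -- ## off `tsupport χ`: both terms vanish
    have hz : ∀ σ : ℝ, iteratedFDeriv ℝ k (fun y => χ y • V σ y) y = 0 := fun σ => by
      rw [((cutoffField_eventuallyEq_zero' (V σ) hy).iteratedFDeriv ℝ k).eq_of_nhds, iteratedFDeriv_fun_zero]
      rfl
    rw [hz τ', hz τ, sub_zero, norm_zero]
    exact hε.le

end CutoffField

/-! ### The package for the Seregin–Zajaczkowski class -/

section Package

/-- **The cut-off globalisation of the Seregin–Zajaczkowski representative.** Let `(V, p)` be in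
the class `IsSmoothAxisymmetricSolutionOn S V p` on an open `S ⊇ I × 𝒞(0, 1)` (`I` open), let
`0 < r₀ < r₁ < 1` and let `χ` be a smooth axisymmetric cut-off with `χ = 1` on `𝒞(r₀)` and
`tsupport χ ⊆ 𝒞(r₁)` (`exists_cylCutoff`). Then `v t = χ • V t` has: globally `C^∞`
axisymmetric slices vanishing off `B̄(0, 2)` for `t ∈ I`; uniform-in-`x` time moduli of all
`D_xᵏv` on `I`; `v t = V t` near every point of `𝒞(r₀)`; `div v = 0` on `I × 𝒞(r₀)`; and the
pointwise vorticity equation `d/ds curl (v s) x = Δω − Dω[v t] + D(v t)[ω]` (`ω = curl (v t)`)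
at every `(t, x) ∈ I × 𝒞(r₀)` (pressure-free: `vorticity_classical_of_isDistributionalNSSolutionOn`).
These are the structural hypotheses under which the Step-3 key estimate for the local class is
proved. Registered sub-goal toward `stub_sereginLogSwirlOrigin`. [folklore] -/
theorem cutoffFamily_package : ∀ (S : TopologicalSpace.Opens (ℝ × EuclideanSpace ℝ (Fin 3))) (V v : ℝ → EuclideanSpace ℝ (Fin 3) → EuclideanSpace ℝ (Fin 3)) (p : ℝ → EuclideanSpace ℝ (Fin 3) → ℝ) (I : Set ℝ) (χ : EuclideanSpace ℝ (Fin 3) → ℝ) (r₀ r₁ : ℝ), SereginZajaczkowski2007.IsSmoothAxisymmetricSolutionOn S V p → IsOpen I → I ×ˢ SereginSverak2009.spaceCyl 0 1 ⊆ (S : Set (ℝ × EuclideanSpace ℝ (Fin 3))) → 0 < r₀ → r₀ < r₁ → r₁ < 1 → ContDiff ℝ (⊤ : ℕ∞) χ → IsAxisymmetricScalar χ → (∀ y ∈ SereginSverak2009.spaceCyl 0 r₀, χ y = 1) → tsupport χ ⊆ SereginSverak2009.spaceCyl 0 r₁ → (∀ t, v t = fun y => χ y • V t y) → (∀ t ∈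 I, ContDiff ℝ (⊤ : ℕ∞) (v t)) ∧ (∀ t ∈ I, IsAxisymmetric (v t)) ∧ (∀ t ∈ I, ∀ y, 2 < ‖y‖ → v t y = 0) ∧ (∀ k : ℕ, ∀ t ∈ I, ∀ ε > 0, ∃ δ > 0, ∀ t' ∈ I, |t' - t| < δ → ∀ y, ‖iteratedFDeriv ℝ k (v t') y - iteratedFDeriv ℝ k (v t) y‖ ≤ ε) ∧ (∀ t ∈ I, ∀ x ∈ SereginSverak2009.spaceCyl 0 r₀, v t =ᶠ[𝓝 x] V t) ∧ (∀ t ∈ I, ∀ x ∈ SereginSverak2009.spaceCyl 0 r₀, VectorCalculus.divergence (v t) x = 0) ∧ (∀ t ∈ I, ∀ x ∈ SereginSverak2009.spaceCyl 0 r₀, HasDerivAt (fun s => curl (v s) x) ((1 : ℝ) • (Δ (curl (v t))) x - fderiv ℝ (curl (v t)) x (v t x) + fderiv ℝ (v t) x (curl (v t) x)) t) := by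
  intro S V v p I χ r₀ r₁ hV hI hsub h₀ h₀₁ h₁ hχ hχax hχ1 hχs hv
  set U : Set (EuclideanSpace ℝ (Fin 3)) := SereginSverak2009.spaceCyl 0 1 with hUdef
  have hU : IsOpen U := SereginSverak2009.isOpen_spaceCyl 0 1
  have hmono : ∀ {r : ℝ}, r ≤ 1 → SereginSverak2009.spaceCyl (0 : EuclideanSpace ℝ (Fin 3)) r ⊆ U := by
    intro r hr y hy
    have hy' : cylRadius y < r ∧ |y 2| < r := by simpa [SereginSverak2009.mem_spaceCyl] using hy
    have : cylRadius y < 1 ∧ |y 2| < 1 := ⟨hy'.1.trans_le hr, hy'.2.trans_le hr⟩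
    simpa [hUdef, SereginSverak2009.mem_spaceCyl] using this
  have hχU : tsupport χ ⊆ U := hχs.trans (hmono h₁.le)
  have hχc : HasCompactSupport χ :=
    IsCompact.of_isClosed_subset (isCompact_closedBall _ _) (isClosed_tsupport χ)
      (hχU.trans spaceCyl_subset_closedBall)
  have hVs : ∀ τ ∈ I, ∀ y ∈ U, ContDiffAt ℝ ∞ (V τ) y := fun τ hτ y hy => hV.contDiffAt (τ, y) (hsub ⟨hτ, hy⟩)
  have hVc : ∀ n : ℕ, ContinuousOn
      (fun w : ℝ × EuclideanSpace ℝ (Fin 3) => iteratedFDeriv ℝ n (V w.1) w.2) (I ×ˢ U) :=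
    fun n => (hV.continuousOn_iteratedFDeriv n).mono hsub
  have hO : IsOpen (SereginSverak2009.spaceCyl (0 : EuclideanSpace ℝ (Fin 3)) r₀) := SereginSverak2009.isOpen_spaceCyl 0 r₀
  have hloc : ∀ t ∈ I, ∀ x ∈ SereginSverak2009.spaceCyl (0 : EuclideanSpace ℝ (Fin 3)) r₀, v t =ᶠ[𝓝 x] V t :=
    fun t _ x hx => by rw [hv t]; exact cutoffField_eventuallyEq' (V t) hO hχ1 hx
  have hsub₀ : I ×ˢ SereginSverak2009.spaceCyl (0 : EuclideanSpace ℝ (Fin 3)) r₀ ⊆ (S : Set (ℝ × EuclideanSpace ℝ (Fin 3))) :=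
    (prod_mono le_rfl (hmono (h₀₁.trans h₁).le)).trans hsub
  refine ⟨fun t ht => ?_, fun t ht => ?_, fun t _ y hy => ?_, ?_, hloc, fun t ht x hx => ?_, fun t ht x hx => ?_⟩
  · rw [hv t]; exact cutoffField_contDiff_of_tsupport_subset hχ hχU (hVs t ht)
  · rw [hv t]
    exact cutoffField_isAxisymmetric_of_tsupport_subset hχax hχU fun θ y hy =>
      hV.axisymmetric θ (t, y) (hsub ⟨ht, hy⟩)
  · have hy' : y ∉ tsupport χ := fun h => by
      have := spaceCyl_subset_closedBall (hχU h)
      rw [mem_closedBall, dist_zero_right] at this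
      linarith
    rw [hv t]
    show χ y • V t y = 0
    rw [image_eq_zero_of_notMem_tsupport hy', zero_smul]
  · intro k t ht ε hε
    obtain ⟨δ, hδ, h⟩ := unifTime_cutoffField_of_tsupport_subset hI hU hχ hχc hχU hVs hVc k t ht ε hε
    refine ⟨δ, hδ, fun t' ht' hlt y => ?_⟩
    rw [hv t', hv t]
    exact h t' ht' hlt y
  · -- `div v = div V = 0` on `I × 𝒞(r₀)`
    have hOI : IsOpen (I ×ˢ U) := hI.prod hU
    have hle : (⟨I ×ˢ U, hOI⟩ : Opens (ℝ × EuclideanSpace ℝ (Fin 3))) ≤ S := hsub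
    have hsol : IsDistributionalNSSolutionOn ⟨I ×ˢ U, hOI⟩ 1 0 V p := hV.suitable.distributional.of_le hle
    have hU3 : ∀ t ∈ I, ContDiffOn ℝ 3 (V t) U := fun t ht x hx =>
      ((hVs t ht x hx).of_le (by norm_cast)).contDiffWithinAt
    obtain ⟨hdiv, -⟩ := vorticity_classical_of_isDistributionalNSSolutionOn hI hU hsol hU3 fun n _ => hVc n
    have hxU : x ∈ U := hmono (h₀₁.trans h₁).le hx
    have h := hdiv (t, x) ⟨ht, hxU⟩
    unfold VectorCalculus.divergence at h ⊢
    rwa [(hloc t ht x hx).fderiv_eq]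
  · have h := hasDerivAt_curl_of_isSmoothAxisymmetricSolutionOn hV hI hO hsub₀ hloc ht hx
    simpa only [one_smul] using h

end Package

end Summit.NavierStokesRegularity.NavierStokesRegularity.Theorems.AxisymmetricKatoGlobal.EulerScaling

end
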